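import Mathlib.LinearAlgebra.Matrix.Rank
import Mathlib.LinearAlgebra.FiniteDimensional.Lemmas
import Literature.Computability.AlgebraicComplexity.BCMV25PermanentalVarieties
import HarnessLib

/-!
# Yu 1999: the permanent rank of a matrix is at least half its rank

Topic `Literature/Computability/AlgebraicComplexity`; theorem-only file (no definitions, no named
facts).  Source: Yang Yu, *The permanent rank of a matrix*, J. Combin. Theory Ser. A 85 (1999)
237–242, doi:10.1006/jcta.1998.2904 (held as `paper:doi-10-1006-jcta-1998-2904`; locators
`p000N Lnn` refer to the materialised text).  "Define the perrank of a matrix `A` to be the size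
of the largest square submatrix of `A` with nonzero permanent" (p0001 L16–18) — this is the tree's
`BoraleviCarliniMichalekVentura2025.prk` (BCMV 2025 Def. 1.1 "after Yu [YY]"); `rsubperm M p q` is
the tree's rectangular subpermanent on the columns `p` and rows `q`.

## What is typed

* `rsubperm_transpose`, `rsubperm_insert_col` — toolkit: transposition symmetry of rectangular
  subpermanents and the expansion of `per[Rw | insert c Cl]` along the column `c` (the tree has the
  row expansion `rsubperm_insert_row`).
* `lemma_1_1` — **Lemma 1.1** (p0001 L22–29: "Suppose `A` is an `n × m` matrix with
  `perrank(A) = m < n`.  Let `(A x)` be the `n × (m+1)` matrix formed by `A` following with the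
  column vector `x`.  Then `dim{x : perrank(A x) = m} ≤ m`."; proof: "the projection of `L` to the
  first `m` coordinates is one to one"), in the coordinate form used by the proof and by Thm. 1.3:
  if `per[Rw | Cl] ≠ 0` with `|Rw| = h`, then every subspace `W ⊆ F^ρ` all of whose vectors `x`
  satisfy the `(h+1) × (h+1)` permanent equations `Σ_{r ∈ R'} x_r · per[R' ∖ r | Cl] = 0`
  (`|R'| = h + 1`; these are the maximal permanents of `(A_{·,Cl} x)` expanded along the column
  `x`) has `dim W ≤ h` (the projection of `W` to the `Rw`-coordinates is injective).
* `thm_1_3` — **Theorem 1.3** (p0002 L13–15: "For any matrix `A`, `perrank(A) ≥ rank(A)/2`."):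
  `A.rank ≤ 2 · prk A` for every matrix over a field, proof as printed (p0002 L17–19: a full
  subpermanent `per[Rw | Cl] ≠ 0` of size `h = prk A`; the columns of `A` outside `Cl` lie in the
  subspace of Lemma 1.1, so the column span has dimension `≤ h + |Cl| = 2h`).  TYPED ⊇ PRINTED:
  the paper's standing hypothesis "`p ∤ 2`" (p0001 L20) is not used by this proof and is dropped
  (in characteristic `2` the permanent is the determinant and the bound is trivial anyway).

## What is NOT typed

* Cor. 1.2 and Cor. 2.6 (probabilities for random matrices), Lemma 1.4 / Thm. 1.5
  (characteristic `3`), Conjectures 2.1 (Alon–Jaeger–Tarsi) and 2.2 (Kahn) — conjectures, not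
  Literature —, Thm. 2.3 / Prop. 2.4 (iterated concatenations `(A₁ A₂ ⋯ A_l)`), Lemma 2.5,
  Lemma 2.7 / Thm. 2.8 (Kantor's inclusion-matrix rank).

Honest framing: V0 dictionary (permanental rank vs rank; the [YY] input of
Boralevi–Carlini–Michałek–Ventura 2025); no rung of any route moves; VP ≠ VNP is NOT proved.

## References

* Y. Yu, *The permanent rank of a matrix*, J. Combin. Theory Ser. A 85 (1999) 237–242,
  doi:10.1006/jcta.1998.2904: Lemma 1.1 (p0001 L22–29), Thm. 1.3 (p0002 L13–19). [YuYang1999]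
  (references.bib key `YuYang1999`; the key `Yu1999` is a different paper).
* A. Boralevi, E. Carlini, M. Michałek, E. Ventura, *On the codimension of permanental
  varieties*, Adv. Math. 461 (2025), arXiv:2402.17839: Def. 1.1 (`prk`).
  [BoraleviCarliniMichalekVentura2025]
-/

noncomputable section

open Matrix MvPolynomial Finset Module

namespace Literature.Computability.AlgebraicComplexity

namespace Yu1999

open BoraleviCarliniMichalekVentura2025

/-! ### §A. Toolkit: transposition and column expansion of rectangular subpermanents -/

section Toolkit

variable {ρ κ : Type*} [Fintype ρ] [Fintype κ] [DecidableEq ρ] [DecidableEq κ]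
  {R : Type*} [CommRing R]

/-- **Transposition symmetry**: the subpermanent of `Mᵀ` on the columns `q` and rows `p` is the
subpermanent of `M` on the columns `p` and rows `q` (`per Aᵀ = per A`). [cite: BurgisserClausenShokrollahi1997, (21.30)] -/
theorem rsubperm_transpose (M : Matrix ρ κ R) (p : κ → Prop) (q : ρ → Prop) [DecidablePred p]
    [DecidablePred q] : rsubperm Mᵀ q p = rsubperm M p q := by
  unfold rsubperm
  refine Fintype.sum_equiv ⟨Equiv.symm, Equiv.symm, fun _ => rfl, fun _ => rfl⟩ _ _ fun g => ?_
  change ∏ r : {r // q r}, Mᵀ (g r) r = ∏ c : {c // p c}, M (g.symm c) c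
  simp only [Matrix.transpose_apply]
  exact Fintype.prod_equiv g (fun r => M r (g r)) (fun c => M (g.symm c) c) fun r => by
    rw [Equiv.symm_apply_apply]

/-- **Expansion of `per[Rw | insert c Cl]` (`c ∉ Cl`) along the column `c`**:
`Σ_{r ∈ Rw} M r c · per[Rw ∖ r | Cl]`. [cite: BurgisserClausenShokrollahi1997, (21.30)] -/
theorem rsubperm_insert_col (M : Matrix ρ κ R) (Rw : Finset ρ) {Cl : Finset κ} {c : κ}
    (hc : c ∉ Cl) :
    rsubperm M (· ∈ insert c Cl) (· ∈ Rw) =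
      ∑ r ∈ Rw, M r c * rsubperm M (· ∈ Cl) (· ∈ Rw.erase r) := by
  rw [← rsubperm_transpose, rsubperm_insert_row Mᵀ hc Rw]
  refine Finset.sum_congr rfl fun r _ => ?_
  rw [Matrix.transpose_apply, rsubperm_transpose]

end Toolkit

/-! ### §B. Lemma 1.1 and Theorem 1.3 -/

section Main

variable {F : Type*} [Field F] {ρ κ : Type*} [Fintype ρ] [Fintype κ] [DecidableEq ρ]
  [DecidableEq κ]

/-- **Yu 1999, Lemma 1.1** ("Suppose `A` is an `n × m` matrix with `perrank(A) = m < n`.  Let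
`(A x)` be the `n × (m+1)` matrix formed by `A` following with the column vector `x`.  Then
`dim{x : perrank(A x) = m} ≤ m`."; proof: "the projection of `L` to the first `m` coordinates is
one to one"), in coordinates: if the `h × h` subpermanent `per[Rw | Cl]` of `A` is nonzero, then a
subspace `W` of column vectors `x` all of which kill the `(h+1) × (h+1)` permanents of `(A_{·,Cl} x)`
through the rows `R'` — expanded along the column `x`: `Σ_{r ∈ R'} per[R' ∖ r | Cl] · x_r = 0` for
every `|R'| = h + 1` — has dimension `≤ h`. [cite: YuYang1999, Lemma 1.1 (JCTA 85 p.237 = text p0001 L22–29)] -/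
theorem lemma_1_1 (A : Matrix ρ κ F) {Rw : Finset ρ} {Cl : Finset κ} {h : ℕ} (hR : Rw.card = h)
    (hne : rsubperm A (· ∈ Cl) (· ∈ Rw) ≠ 0) (W : Submodule F (ρ → F))
    (hW : ∀ x ∈ W, ∀ R' : Finset ρ, R'.card = h + 1 →
      ∑ r ∈ R', rsubperm A (· ∈ Cl) (· ∈ R'.erase r) * x r = 0) :
    finrank F W ≤ h := by
  classical
  -- the projection to the `Rw`-coordinates
  let π : W →ₗ[F] (Rw → F) :=
    (LinearMap.pi fun r : Rw => (LinearMap.proj (r : ρ) : (ρ → F) →ₗ[F] F)).comp W.subtype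
  have hinj : Function.Injective π := by
    rw [injective_iff_map_eq_zero]
    rintro ⟨x, hx⟩ h0
    have hzero : ∀ r ∈ Rw, x r = 0 := fun r hr => by
      have := congr_fun h0 ⟨r, hr⟩
      simpa [π] using this
    ext i
    change x i = 0
    by_cases hi : i ∈ Rw
    · exact hzero i hi
    · -- the equation of the rows `insert i Rw`: `per[Rw | Cl] · x i + Σ_{r ∈ Rw} (…) · x r = 0`
      have hcard : (insert i Rw).card = h + 1 := by rw [Finset.card_insert_of_notMem hi, hR]
      have heq := hW x hx (insert i Rw) hcard
      rw [Finset.sum_insert hi, Finset.erase_insert hi,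
        Finset.sum_eq_zero (fun r hr => by rw [hzero r hr, mul_zero]), add_zero] at heq
      exact (mul_eq_zero.1 heq).resolve_left hne
  calc finrank F W ≤ finrank F (Rw → F) := LinearMap.finrank_le_finrank_of_injective hinj
    _ = h := by rw [Module.finrank_fintype_fun_eq_card, Fintype.card_coe, hR]

/-- **Yu 1999, Theorem 1.3** ("For any matrix `A`, `perrank(A) ≥ rank(A)/2`."), typed as
`rank A ≤ 2 · prk A` for every matrix over a field (the paper's standing "`char F ≠ 2`" is not needed
and is dropped; `prk` = BCMV's permanental rank = Yu's perrank).  Proof as printed: with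
`h = prk A` and `per[Rw | Cl] ≠ 0`, `|Rw| = |Cl| = h`, every column of `A` outside `Cl` lies in the
subspace of Lemma 1.1 (all `(h+1) × (h+1)` subpermanents of `A` vanish), whose dimension is `≤ h`;
hence the column span has dimension `≤ h + |Cl| = 2h`. [cite: YuYang1999, Thm. 1.3 (JCTA 85 p.238 = text p0002 L13–19)] -/
theorem thm_1_3 (A : Matrix ρ κ F) : A.rank ≤ 2 * prk A := by
  classical
  -- a nonzero subpermanent of size `h = prk A`
  have hmem : prk A ∈ {h | ∃ (Rw : Finset ρ) (Cl : Finset κ), Rw.card = h ∧ Cl.card = h ∧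
      rsubperm A (· ∈ Cl) (· ∈ Rw) ≠ 0} := by
    unfold prk
    refine Nat.sSup_mem ⟨0, ∅, ∅, rfl, rfl, ?_⟩ ⟨Fintype.card ρ, ?_⟩
    · rw [rsubperm_of_isEmpty A (fun i => Finset.notMem_empty i) (fun j => Finset.notMem_empty j)]
      exact one_ne_zero
    · rintro h ⟨Rw, -, hR, -, -⟩
      exact hR ▸ Finset.card_le_univ Rw
  obtain ⟨Rw, Cl, hR, hC, hne⟩ := hmem
  set h := prk A with hh
  -- the span of the columns outside `Cl` satisfies the equations of Lemma 1.1
  let W : Submodule F (ρ → F) := Submodule.span F (Set.range fun j : {j // j ∉ Cl} => A.col j)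
  have hW : ∀ x ∈ W, ∀ R' : Finset ρ, R'.card = h + 1 →
      ∑ r ∈ R', rsubperm A (· ∈ Cl) (· ∈ R'.erase r) * x r = 0 := by
    intro x hx R' hR'
    induction hx using Submodule.span_induction with
    | mem x hx =>
      obtain ⟨⟨j, hj⟩, rfl⟩ := hx
      -- the `(h+1) × (h+1)` permanent `per[R' | insert j Cl]`, expanded along the column `j`
      have hexp := rsubperm_insert_col A R' hj
      have hzero : rsubperm A (· ∈ insert j Cl) (· ∈ R') = 0 :=
        (forall_rsubperm_eq_zero_iff_prk_lt A (by omega : 1 ≤ h + 1)).2 (by omega) R' _ hR'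
          (by rw [Finset.card_insert_of_notMem hj, hC])
      rw [hzero] at hexp
      rw [hexp]
      exact Finset.sum_congr rfl fun r _ => mul_comm _ _
    | zero => simp
    | add x y _ _ hx hy => simp only [Pi.add_apply, mul_add, Finset.sum_add_distrib, hx, hy, add_zero]
    | smul a x _ hx =>
      simp only [Pi.smul_apply, smul_eq_mul, mul_left_comm _ a, ← Finset.mul_sum, hx, mul_zero]
  have hdimW : finrank F W ≤ h := lemma_1_1 A hR hne W hW
  -- the column span is inside `W + span (columns in Cl)`
  have hsplit : Submodule.span F (Set.range A.col) ≤
      W ⊔ Submodule.span F (Set.range fun j : Cl => A.col j) := by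
    rw [Submodule.span_le]
    rintro v ⟨j, rfl⟩
    by_cases hj : j ∈ Cl
    · exact Submodule.mem_sup_right (Submodule.subset_span ⟨⟨j, hj⟩, rfl⟩)
    · exact Submodule.mem_sup_left (Submodule.subset_span ⟨⟨j, hj⟩, rfl⟩)
  have hdimC : finrank F (Submodule.span F (Set.range fun j : Cl => A.col j)) ≤ h :=
    (finrank_range_le_card _).trans (by rw [Fintype.card_coe, hC])
  rw [Matrix.rank_eq_finrank_span_cols]
  calc finrank F (Submodule.span F (Set.range A.col))
      ≤ finrank F ↥(W ⊔ Submodule.span F (Set.range fun j : Cl => A.col j)) :=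
        Submodule.finrank_mono hsplit
    _ ≤ finrank F W + finrank F (Submodule.span F (Set.range fun j : Cl => A.col j)) :=
        Submodule.finrank_add_le_finrank_add_finrank _ _
    _ ≤ h + h := add_le_add hdimW hdimC
    _ = 2 * prk A := by rw [hh]; ring

end Main

end Yu1999

end Literature.Computability.AlgebraicComplexity
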